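import Mathlib.GroupTheory.Perm.Centralizer
import Literature.Combinatorics.Sahi2008.CycleForm
import HarnessLib

/-!
# Lieb–Sahi (2022), Lemma 4.1: the diagonal `E_n(f,…,f)` as a signed sum of power-sum moments over the
# partitions of `n`

Topic `Literature/Combinatorics/Sahi2008`; companion of `CycleForm.lean` (Lieb–Sahi's Definition 3.1,
`sahiECycle μ n f = Σ_{σ ∈ S_n} (−1)^{C_σ − 1} E_σ(f)`, proved equal to the tree's `sahiE` for `n ≥ 1`, with the
cycles of `σ` as the finite sets `CycleForm.orbit σ i ∈ CycleForm.orbits σ`).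

## Source (corpus `paper:arxiv-2107.09838`, p. 12 = J. Math. Phys. 63 (2022), Appendix), verbatim

> "A partition `λ` of `n`, of length `l`, is a weakly decreasing sequence of positive integers
> `λ_1 ≥ λ_2 ≥ ⋯ ≥ λ_l > 0` such that `λ_1 + ⋯ + λ_l = n`; … we write `l(λ) = l` and `|λ| = n`.  The conjugation
> action of `S_n` permutes the indices in the cycle decomposition (13) of an element `σ`.  Thus the class of `σ`
> is uniquely determined by its "cycle type", i.e. the partition `λ` whose parts are the cycle lengths of `σ`
> … if `m_i = m_i(λ)` denotes the number of parts of size `i`, then the conjugacy class of cycle type `λ`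
> contains `n!/z_λ` elements where `z_λ = Π_{i ≥ 1} i^{m_i} (m_i)!`.  For a function `f` on a probability space,
> we define its moments by the formula `p_d(f) = 𝔼(f^d)` and `p_λ(f) = p_{λ_1}(f) ⋯ p_{λ_l}(f)`.
> **LEMMA 4.1.** We have `E_n(f,…,f) = n! Σ_{|λ|=n} (−1)^{l(λ)−1} z_λ^{−1} p_λ(f)`.
> *Proof:* If `σ` is of class `λ`, then the number of disjoint cycles in `σ` is `l(λ)` and by (14) we have
> `E_σ(f,…,f) = p_λ(f)`.  Thus the sum (15) for `E_n(f,…,f)` is constant over conjugacy classes, with class `λ`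
> contributing `n!/z_λ` identical terms. This implies the result."

## What is formalised (everything PROVED; no named facts; axioms standard)

* `CycleForm.cycleClass σ : n.Partition` — the cycle type of `σ ∈ S_n`, its parts being the cycle lengths
  (fixed points are parts `1`); `zee λ = Π_i i^{m_i} m_i!`; `pMoment μ f λ = Π_j E(f^{λ_j})`.
* The printed proof, step by step: `E_σ(f,…,f) = p_λ(f)` and `C_σ = l(λ)` for `σ` of class `λ`
  (`CycleForm.cycleE_const`, `CycleForm.card_orbits_eq`); the class of `λ` has `n!/z_λ` elements
  (`CycleForm.card_cycleClass_mul_zee`, from Mathlib's count of the permutations of a given cycle type,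
  `Equiv.Perm.card_of_cycleType_mul_eq`, through the bridge `CycleForm.orbits_val_map_card`: the cycle lengths of
  `σ` are Mathlib's `σ.cycleType` together with one `1` per fixed point, i.e. `σ.partition.parts`);
  and **Lemma 4.1** (`liebSahi_lemma41`) for the tree's `sahiE`, every `n ≥ 1`, every finite weighted space.

Motivation: crux `stmt-CriticalPhenomena-4575` (cell prim-sahi) — with this file every numbered statement of
[LiebSahi2021, §§3–4] has a tree declaration (`GeneratingFunction.lean` proves Props. 4.2/4.3 and Thm. 4.4 by a
route that bypasses Lemma 4.1).
-/

noncomputable section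

namespace Literature.Combinatorics.Sahi2008

open Finset Function Equiv Equiv.Perm
open scoped Nat

variable {α : Type*} [Fintype α]

namespace CycleForm

/-! ### The cycles (13) versus Mathlib's cycle factors -/

section Bridge

variable {κ : Type*} [Fintype κ] [DecidableEq κ]

/-- On the support, the cycle of `σ` through `x` is the support of Mathlib's cycle factor `σ.cycleOf x`.
[cite: LiebSahi2021, §3.1 eq. (13) (p. 7)] -/
theorem orbit_eq_support_cycleOf {σ : Perm κ} {x : κ} (hx : x ∈ σ.support) :
    orbit σ x = (σ.cycleOf x).support := by
  ext y
  rw [mem_orbit, mem_support_cycleOf_iff' (mem_support.1 hx)]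

/-- A fixed point is a cycle of length one. [cite: LiebSahi2021, §3.1 eq. (13) (p. 7)] -/
theorem orbit_eq_singleton {σ : Perm κ} {x : κ} (hx : σ x = x) : orbit σ x = {x} := by
  ext y
  rw [mem_orbit, mem_singleton]
  constructor
  · rintro ⟨i, rfl⟩
    exact zpow_apply_eq_self_of_apply_eq_self hx i
  · rintro rfl
    exact SameCycle.refl σ y

/-- The cycle factors of `σ` are the `σ.cycleOf x`, `x` in the support. [cite: LiebSahi2021, §3.1 eq. (13) (p. 7)] -/
theorem cycleFactorsFinset_eq_image (σ : Perm κ) : σ.cycleFactorsFinset = σ.support.image σ.cycleOf := by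
  ext c
  rw [mem_image]
  constructor
  · intro hc
    obtain ⟨a, ha⟩ := (mem_cycleFactorsFinset_iff.1 hc).1.nonempty_support
    exact ⟨a, mem_cycleFactorsFinset_support_le hc ha, (cycle_is_cycleOf ha hc).symm⟩
  · rintro ⟨a, ha, rfl⟩
    exact cycleOf_mem_cycleFactorsFinset_iff.2 ha

/-- Distinct cycle factors have distinct supports. [cite: LiebSahi2021, §3.1 eq. (13) (p. 7)] -/
theorem support_injOn_cycleFactorsFinset (σ : Perm κ) :
    Set.InjOn Perm.support (σ.cycleFactorsFinset : Set (Perm κ)) := by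
  intro c hc d hd h
  obtain ⟨a, ha⟩ := (mem_cycleFactorsFinset_iff.1 hc).1.nonempty_support
  have ha' : a ∈ d.support := h ▸ ha
  rw [cycle_is_cycleOf ha hc, cycle_is_cycleOf ha' hd]

/-- **The cycle lengths of `σ`, fixed points counted as cycles of length one, are Mathlib's `σ.cycleType` with
one part `1` added per fixed point** (= `σ.partition.parts`). [cite: LiebSahi2021, Appendix (p. 12, "the partition
`λ` whose parts are the cycle lengths of `σ`")] -/
theorem orbits_val_map_card (σ : Perm κ) :
    (orbits σ).val.map Finset.card =
      σ.cycleType + Multiset.replicate (Fintype.card κ - σ.support.card) 1 := by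
  have hdisj : Disjoint (σ.support.image (orbit σ)) (σ.supportᶜ.image (orbit σ)) := by
    refine disjoint_left.2 fun B hB hB' => ?_
    obtain ⟨x, hx, rfl⟩ := mem_image.1 hB
    obtain ⟨y, hy, hxy⟩ := mem_image.1 hB'
    rw [orbit_eq_singleton (notMem_support.1 (mem_compl.1 hy))] at hxy
    have hx' : x ∈ ({y} : Finset κ) := hxy ▸ self_mem_orbit σ x
    rw [mem_singleton] at hx'
    exact (mem_compl.1 hy) (hx' ▸ hx)
  have hsplit : orbits σ = (σ.support.image (orbit σ)).disjUnion (σ.supportᶜ.image (orbit σ)) hdisj := by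
    rw [disjUnion_eq_union, ← image_union, union_compl]
    rfl
  rw [hsplit]
  show Multiset.map Finset.card ((σ.support.image (orbit σ)).val + (σ.supportᶜ.image (orbit σ)).val) = _
  rw [Multiset.map_add]
  congr 1
  · have h1 : σ.support.image (orbit σ) = σ.cycleFactorsFinset.image Perm.support := by
      rw [cycleFactorsFinset_eq_image, image_image]
      exact image_congr fun x hx => orbit_eq_support_cycleOf (mem_coe.1 hx)
    rw [h1, image_val_of_injOn (support_injOn_cycleFactorsFinset σ), Multiset.map_map, cycleType_def]
  · have h2 : σ.supportᶜ.image (orbit σ) = σ.supportᶜ.image (fun x => ({x} : Finset κ)) :=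
      image_congr fun x hx => orbit_eq_singleton (notMem_support.1 (mem_compl.1 (mem_coe.1 hx)))
    rw [h2, image_val_of_injOn (singleton_injective.injOn), Multiset.map_map]
    have h3 : (Finset.card ∘ fun x : κ => ({x} : Finset κ)) = fun _ => 1 := by
      funext x
      simp
    rw [h3, Multiset.map_const', ← card_compl]
    rfl

end Bridge

/-! ### Cycle type as a partition of `n`; `z_λ`; `p_λ(f)` -/

variable {n : ℕ}

/-- **The class (cycle type) of `σ ∈ S_n`**: "the partition `λ` whose parts are the cycle lengths of `σ`"
(fixed points are parts `1`). [cite: LiebSahi2021, Appendix (p. 12)] -/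
def cycleClass (σ : Perm (Fin n)) : Nat.Partition n where
  parts := (orbits σ).val.map Finset.card
  parts_pos := by
    intro i hi
    obtain ⟨B, hB, rfl⟩ := Multiset.mem_map.1 hi
    have hB' : B ∈ univ.image (orbit σ) := Finset.mem_def.2 hB
    obtain ⟨x, -, rfl⟩ := mem_image.1 hB'
    exact card_pos.2 ⟨x, self_mem_orbit σ x⟩
  parts_sum := by
    rw [orbits_val_map_card, ← parts_partition, σ.partition.parts_sum, Fintype.card_fin]

/-- The parts of the class of `σ`. [cite: LiebSahi2021, Appendix (p. 12)] -/
theorem cycleClass_parts (σ : Perm (Fin n)) : (cycleClass σ).parts = (orbits σ).val.map Finset.card :=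
  rfl

/-- **`z_λ = Π_{i ≥ 1} i^{m_i} (m_i)!`**, `m_i` the number of parts of `λ` equal to `i`.
[cite: LiebSahi2021, Appendix (p. 12)] -/
def zee (la : Nat.Partition n) : ℕ :=
  ∏ i ∈ la.parts.toFinset, i ^ la.parts.count i * (la.parts.count i)!

/-- **`p_λ(f) = p_{λ_1}(f) ⋯ p_{λ_l}(f)`**, `p_d(f) = E(f^d)`. [cite: LiebSahi2021, Appendix (p. 12)] -/
def pMoment (μ : α → ℝ) (f : α → ℝ) (la : Nat.Partition n) : ℝ :=
  (la.parts.map fun d => ex μ fun x => f x ^ d).prod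

/-- "If `σ` is of class `λ`, then the number of disjoint cycles in `σ` is `l(λ)`".
[cite: LiebSahi2021, proof of Lemma 4.1 (p. 12)] -/
theorem card_orbits_eq (σ : Perm (Fin n)) : (orbits σ).card = (cycleClass σ).parts.card := by
  rw [cycleClass_parts, Multiset.card_map]
  rfl

/-- "and by (14) we have `E_σ(f,…,f) = p_λ(f)`". [cite: LiebSahi2021, proof of Lemma 4.1 (p. 12)] -/
theorem cycleE_const (μ : α → ℝ) (f : α → ℝ) (σ : Perm (Fin n)) :
    cycleE μ (fun _ : Fin n => f) σ = pMoment μ f (cycleClass σ) := by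
  unfold cycleE pMoment
  rw [cycleClass_parts, Multiset.map_map, ← prod_eq_multiset_prod]
  refine prod_congr rfl fun B _ => ?_
  simp only [Function.comp_apply, prod_const]

/-- Parts smaller than `2` of a partition are `1`'s. [folklore] -/
private theorem filter_not_two_le (la : Nat.Partition n) :
    la.parts.filter (fun i => ¬2 ≤ i) = Multiset.replicate (la.parts.count 1) 1 := by
  rw [Multiset.eq_replicate, Multiset.count_eq_card_filter_eq]
  constructor
  · congr 1
    exact Multiset.filter_congr fun i hi => by
      have := la.parts_pos hi
      omega
  · intro b hb
    have := la.parts_pos (Multiset.mem_filter.1 hb).1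
    have := (Multiset.mem_filter.1 hb).2
    omega

/-- `m_1(λ) + Σ_{parts ≥ 2} = n`. [folklore] -/
private theorem count_one_add_sum_filter (la : Nat.Partition n) :
    la.parts.count 1 + (la.parts.filter fun i => 2 ≤ i).sum = n := by
  have h := congrArg Multiset.sum (Multiset.filter_add_not (fun i => 2 ≤ i) la.parts)
  rw [Multiset.sum_add, filter_not_two_le, Multiset.sum_replicate, smul_eq_mul, mul_one, la.parts_sum] at h
  omega

/-- A partition is determined by its parts `≥ 2`. [folklore] -/
private theorem partition_eq_of_filter_eq {la lb : Nat.Partition n}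
    (h : (la.parts.filter fun i => 2 ≤ i) = lb.parts.filter fun i => 2 ≤ i) : la = lb := by
  have hc : la.parts.count 1 = lb.parts.count 1 := by
    have h1 := count_one_add_sum_filter la
    have h2 := count_one_add_sum_filter lb
    rw [h] at h1
    omega
  ext1
  rw [← Multiset.filter_add_not (fun i => 2 ≤ i) la.parts, ← Multiset.filter_add_not (fun i => 2 ≤ i) lb.parts,
    filter_not_two_le, filter_not_two_le, h, hc]

/-- `σ` is of class `λ` iff Mathlib's `σ.cycleType` (the cycle lengths `≥ 2`) is `λ` with its `1`'s removed.
[cite: LiebSahi2021, Appendix (p. 12)] -/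
theorem cycleClass_eq_iff (σ : Perm (Fin n)) (la : Nat.Partition n) :
    cycleClass σ = la ↔ σ.cycleType = la.parts.filter fun i => 2 ≤ i := by
  have hparts : ((cycleClass σ).parts.filter fun i => 2 ≤ i) = σ.cycleType := by
    rw [cycleClass_parts, orbits_val_map_card, ← parts_partition]
    exact filter_parts_partition_eq_cycleType
  constructor
  · rintro rfl
    exact hparts.symm
  · intro h
    exact partition_eq_of_filter_eq (by rw [hparts, h])

/-- `z_λ` in Mathlib's normal form: `z_λ = m_1! · (Π_{parts i ≥ 2} i) · Π_{i ≥ 2} m_i!`. [folklore] -/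
private theorem zee_eq (la : Nat.Partition n) :
    zee la = (n - (la.parts.filter fun i => 2 ≤ i).sum)! * (la.parts.filter fun i => 2 ≤ i).prod *
      ∏ a ∈ (la.parts.filter fun i => 2 ≤ i).toFinset, ((la.parts.filter fun i => 2 ≤ i).count a)! := by
  set m := la.parts.filter fun i => 2 ≤ i with hm
  have hc1 : la.parts.count 1 = n - m.sum := by
    have := count_one_add_sum_filter la
    rw [← hm] at this
    omega
  unfold zee
  rw [← prod_filter_mul_prod_filter_not la.parts.toFinset (fun i => 2 ≤ i)]
  have h1 : ∏ i ∈ la.parts.toFinset with 2 ≤ i, i ^ la.parts.count i * (la.parts.count i)! =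
      m.prod * ∏ a ∈ m.toFinset, (m.count a)! := by
    rw [← Multiset.toFinset_filter, prod_multiset_count m, ← prod_mul_distrib]
    refine prod_congr rfl fun a ha => ?_
    have ha2 : 2 ≤ a := (Multiset.mem_filter.1 (Multiset.mem_toFinset.1 ha)).2
    rw [hm, Multiset.count_filter_of_pos ha2]
  have h2 : ∏ i ∈ la.parts.toFinset with ¬2 ≤ i, i ^ la.parts.count i * (la.parts.count i)! =
      (la.parts.count 1)! := by
    by_cases h1m : 1 ∈ la.parts
    · have hF : (la.parts.toFinset.filter fun i => ¬2 ≤ i) = {1} := by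
        ext a
        rw [mem_filter, Multiset.mem_toFinset, mem_singleton]
        constructor
        · rintro ⟨ha, ha2⟩
          have := la.parts_pos ha
          omega
        · rintro rfl
          exact ⟨h1m, by omega⟩
      rw [hF, prod_singleton, one_pow, one_mul]
    · have hF : (la.parts.toFinset.filter fun i => ¬2 ≤ i) = ∅ := by
        refine filter_eq_empty_iff.2 fun a ha ha2 => ?_
        have ha' := Multiset.mem_toFinset.1 ha
        have := la.parts_pos ha'
        have h1a : a = 1 := by omega
        exact h1m (h1a ▸ ha')
      rw [hF, prod_empty, Multiset.count_eq_zero.2 h1m, Nat.factorial_zero]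
  rw [h1, h2, hc1]
  ring

/-- "the conjugacy class of cycle type `λ` contains `n!/z_λ` elements": `#{σ ∈ S_n : σ of class λ} · z_λ = n!`.
[cite: LiebSahi2021, Appendix (p. 12)] -/
theorem card_cycleClass_mul_zee (la : Nat.Partition n) :
    (univ.filter fun σ : Perm (Fin n) => cycleClass σ = la).card * zee la = n ! := by
  have hfilter : (univ.filter fun σ : Perm (Fin n) => cycleClass σ = la) =
      univ.filter fun σ : Perm (Fin n) => σ.cycleType = la.parts.filter fun i => 2 ≤ i :=
    filter_congr fun σ _ => cycleClass_eq_iff σ la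
  have hsum : (la.parts.filter fun i => 2 ≤ i).sum ≤ Fintype.card (Fin n) := by
    rw [Fintype.card_fin]
    have := count_one_add_sum_filter la
    omega
  have h := card_of_cycleType_mul_eq (α := Fin n) (la.parts.filter fun i => 2 ≤ i)
  rw [if_pos ⟨hsum, fun a ha => (Multiset.mem_filter.1 ha).2⟩, Fintype.card_fin, ← zee_eq, ← hfilter] at h
  exact h

/-- `z_λ ≠ 0`. [cite: LiebSahi2021, Appendix (p. 12)] -/
theorem zee_ne_zero (la : Nat.Partition n) : zee la ≠ 0 := fun h => by
  have := card_cycleClass_mul_zee la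
  rw [h, mul_zero] at this
  exact Nat.factorial_ne_zero n this.symm

end CycleForm

open CycleForm

/-- **Lemma 4.1 (Lieb–Sahi 2022).**  `E_n(f,…,f) = n! Σ_{|λ| = n} (−1)^{l(λ)−1} z_λ^{−1} p_λ(f)` — for the tree's
`E_n = sahiE μ n` on a finite weighted space, every `n ≥ 1` (at `n = 0` the tree's junk value is `E_0 = 0` while
the right-hand side is empty anyway), `l(λ)` = number of parts, `z_λ = Π i^{m_i} m_i!`, `p_λ(f) = Π_j E(f^{λ_j})`.
Proof as printed: the cycle form (15) is constant on the class of `λ`, which has `n!/z_λ` elements.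
[cite: LiebSahi2021, Lemma 4.1 (p. 12)] -/
theorem liebSahi_lemma41 (μ : α → ℝ) {n : ℕ} (hn : 1 ≤ n) (f : α → ℝ) :
    sahiE μ n (fun _ => f) =
      n ! * ∑ la : Nat.Partition n, (-1 : ℝ) ^ (la.parts.card - 1) * ((zee la : ℝ)⁻¹ * pMoment μ f la) := by
  rw [sahiE_eq_sahiECycle μ n hn, sahiECycle]
  have hG : ∀ σ : Perm (Fin n), (-1 : ℝ) ^ ((orbits σ).card - 1) * cycleE μ (fun _ : Fin n => f) σ =
      (-1 : ℝ) ^ ((cycleClass σ).parts.card - 1) * pMoment μ f (cycleClass σ) := fun σ => by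
    rw [card_orbits_eq, cycleE_const]
  rw [sum_congr rfl fun σ _ => hG σ,
    ← sum_fiberwise univ cycleClass fun σ => (-1 : ℝ) ^ ((cycleClass σ).parts.card - 1) * pMoment μ f (cycleClass σ),
    mul_sum]
  refine sum_congr rfl fun la _ => ?_
  rw [sum_congr rfl fun σ hσ => by rw [(mem_filter.1 hσ).2], sum_const, nsmul_eq_mul]
  have hz : (zee la : ℝ) ≠ 0 := Nat.cast_ne_zero.2 (zee_ne_zero la)
  have hc : ((univ.filter fun σ : Perm (Fin n) => cycleClass σ = la).card : ℝ) = n ! * (zee la : ℝ)⁻¹ := by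
    rw [eq_mul_inv_iff_mul_eq₀ hz]
    exact_mod_cast card_cycleClass_mul_zee la
  rw [hc]
  ring

end Literature.Combinatorics.Sahi2008

end
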